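/-
Copyright (c) 2026 the pub-hodgecm-mathlib formalisation cell (harness21).  Prover seat hodgecm-mathlib-R90-CS-p03 (g4), Track B ∕ R90-TF, h413 = `stmt-HodgeConjecture-24833`,
R90-TF section S8 «ContSpec-n½» (S8 dealer R90-CS-plan (g3) S8-R245 (a) 2026-09-05T03:10:43Z «A ROAD FOR hW1», census `R90/S8/CENSUS-hW1-TauStable.R90-CS-p03-g4.md`
4b2bbfb3106ffbc8): the (R)′ ∕ (M) ∕ (V♭) letter `hW1 : resGMidBlock ξ μω ≤ resGMidBlockτ ξ μω` («unprinted as typed», J-S8-W1) HYPOTHESIS-FIRST from the finite-adelic smoothing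
letter (hFIN) and the `K_∞`-type stability letter (hstab), with the Peter–Weyl density step DISCHARGED.
-/
import Summits.HodgeConjecture.HodgeConjecture.Theorems.R90S8ResGMidBlockDiscreteOfKTypesU3   -- ★ (C133-p02 (g2)): `resGMidAtom_le_resGMidAtom_bot`, `resGMidBlock_eq_generate_resGMidAtom_bot`; brings ★ D1–D3 `resGMidAtomGen ∕ resGMidAtom ∕ resGMidBlock ∕ resGMidBlock_le`
import Summits.HodgeConjecture.HodgeConjecture.Theorems.R90S8ResGMidAtomTauU3Defs           -- ★ τ-DEFS (typ2): `IsTauLevel`, `tauLevel`, `resGMidAtomGenτ ∕ resGMidAtomτ ∕ resGMidBlockτ`, `resGMidAtomτ_le_resGMidBlockτ`, `mem_resGMidAtomτ_of_mem_gen`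
import Summits.HodgeConjecture.HodgeConjecture.Theorems.R90S8ResGIsotypicDensityU3           -- ★ (K2E1-p14 (g3)): `le_topologicalClosure_iSup_inf_isotypicComponent_of_invariant` (Peter–Weyl on a closed stable subspace), `compactSpace_arch_inf_unitaryOne`,
                                                                                              --   `continuous_inclusion_arch_inf_unitaryOne`; brings ★ `isUnitary_rightRegular`, `isStronglyContinuous_rightRegular_holds`, `continuous_archToAdelic`
import Literature.NumberTheory.Automorphic.CompactGroupCharacterProjectionIsotypic           -- ★ Literature: `charProj_eq_zero_iff_mem_orthogonal`, `isIrreducible_of_isTopIrreducible`, `finiteDimensional_of_isTopIrreducible_toContRep`; brings ★ `Schur.charProj`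
import Literature.NumberTheory.Automorphic.DiscreteSummandProjection                       -- ★ Literature: `ClosedSubrep.starProjection_map_apply` (the orthogonal projection onto a closed subrepresentation intertwines)
import HarnessLib

/-!
# S8 (R)′ ∕ (M) ∕ (V♭) letter `hW1` — `R90S8ResGMidBlockLeTauOfIsotypicProjectionU3`: `resGMidBlock ξ μω ≤ resGMidBlockτ ξ μω` FROM the finite-adelic smoothing letter (hFIN) and the
# `K_∞`-type stability letter (hstab), the Peter–Weyl separation step being PROVED here

Track B ∕ R90-TF, crux h413 = `stmt-HodgeConjecture-24833`, route of record `HCCMUnconditional`; cell `hodgecm-mathlib`, R90-TF section S8 «ContSpec-n½», the letter `hW1` of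
(R)′ `sock_S8_res_midBlock_le_residual` (B ED. 7 :337; ★ `res_midBlock_le_residual_of_tauAdmissible (hW1) …`), of (M) :299 and of (V♭) :406 (★ p864870
`resGMidBlock_eq_bot_of_not_lHalfNeZero_of_record (hW1) …`).  THEOREMS ONLY (no `def`, no `instance`, no `notation`, no named-fact hypothesis, no `sorry`; default heartbeats);
lane `--supports stmt-HodgeConjecture-24833 --as helper` (count-neutral).  CLOSES NO SOCKET: it turns ONE unprinted letter into TWO named letters of different kind, each with a
payment road, and pays the third (Peter–Weyl) outright.

THE MATHEMATICS ([MoeglinWaldspurger1995] I.2.17–I.2.18, II.1, V.3.13; [BrockerTomDieck1985] III (5.4)–(5.5), Thm. (5.10); [DeitmarEchterhoff2014] Prop. 7.3.3; [BorelJacquet1979]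
§4.1, §4.6).  ★ D1 `resGMidAtomGen ξ μω K′ ω` admits EVERY continuous pair-section at EVERY `(K′, ω)`; by level antitonicity (★ `resGMidAtom_le_resGMidAtom_bot`, ★
`resGMidBlock_eq_generate_resGMidAtom_bot`) the hull `resGMidBlock ξ μω` is generated by the LEVEL-FREE atom `A_⊥ := resGMidAtom ξ μω ⊥ 1` alone, so (§1)
`hW1 ⟺ A_⊥ ≤ resGMidBlockτ ξ μω ⟺ resGMidAtomGen ξ μω ⊥ 1 ⊆ resGMidBlockτ ξ μω`: hW1 says that the middle-pole residue class of a MERELY CONTINUOUS, LEVEL-FREE section lies in the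
closed `G(𝔸)`-hull of the residue classes of the `K_∞`-FINITE sections at τ-LEVELS `ι_f(U₀)` (`U₀ ≤ G(𝒪̂)_f` open compact) — a statement printed for smooth `K`-finite sections only
[MW95 II.1, V.3.13], whence «L, unprinted as typed» (J-S8-W1).  The road (S8-R245 (a), corrected by the census' finite-level finding) has two smoothing steps and one density step:
* (hFIN) — FINITE-ADELIC SMOOTHING: `A_⊥ ≤ closure ⨆_{U₀ τ-level} resGMidAtom ξ μω (ι_f U₀) 1` (the level idempotents `e_{U₀} = ν(U₀)⁻¹𝟙_{U₀}` ★ `exists_levelIdempotent` tend strongly to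
  `1` as `U₀ → 1`, and the `U₀`-average of a level-free datum is a datum at level `ι_f U₀`); a NAMED letter here (M; the finite half of hW1, no `K_∞`-finiteness, no hull).
* (hstab) — `K_∞`-TYPE STABILITY AT τ-LEVELS: for every τ-level `U₀`, every generator `f ∈ resGMidAtomGen ξ μω (ι_f U₀) 1` and every irreducible unitary finite-dimensional
  `τ` of the compact `K_∞ = U(J₃)(L⁺⊗ℝ) ∩ U(1⊗1)` (★ `compactSpace_arch_inf_unitaryOne`), the `K_∞`-type cut `P_τ f = dim τ • ∫_{K_∞} conj χ_τ(k) • R(ι_∞ k) f dk` (★ Literature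
  `Schur.charProj`, J-S8-E16 — not rebuilt) is a τ-ADMISSIBLE generator `∈ resGMidAtomGenτ ξ μω U₀` (the projected datum `(e_τ φ, e_τ Ec, Sp, e_τ Fp)` is a D1 datum at the same
  τ-level and `e_τ φ` is `K_∞`-finite [BT85 III (5.10)], Fubini on `K_∞`); a NAMED letter here = LH4-p10 (g9)'s `admissible_kTypeProj` (S8-R245 (b)) read in `L²`.
* PETER–WEYL SEPARATION (§2, PROVED): for a unitary strongly continuous representation `σ` of a compact Hausdorff group on a Hilbert space, a CLOSED `σ`-STABLE `W` and a vector `f`,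
  if `P_τ f ∈ W` for every irreducible unitary finite-dimensional `τ` then `f ∈ W`: the orthogonal projection `P_W` intertwines `σ` (★ `ClosedSubrep.starProjection_map_apply`), so it
  commutes with the Bochner integral `P_τ` and `P_τ (f − P_W f) = (1 − P_W)(P_τ f) = 0`; hence `f − P_W f ⟂` every isotypic component (★ `charProj_eq_zero_iff_mem_orthogonal`
  [BT85 III (5.10)(iv)]), i.e. `⟂` the dense span of the irreducible closed subrepresentations (★ `le_topologicalClosure_iSup_inf_isotypicComponent_of_invariant` at `W := ⊤`, each
  irreducible closed subrepresentation being finite-dimensional ★ `finiteDimensional_of_isTopIrreducible_toContRep` and a member of its own isotypic component), so `f = P_W f ∈ W`.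
Composition (§3): for a τ-level `U₀` and `f ∈ resGMidAtomGen (ι_f U₀) 1`, §2 at `σ := R ∘ ι_∞|_{K_∞}` (unitary ★ `isUnitary_rightRegular`, strongly continuous ★
`isStronglyContinuous_rightRegular_holds` ∘ ★ `continuous_archToAdelic`) and `W := resGMidBlockτ` (closed, `R(G(𝔸))`-stable) with (hstab) and ★ `mem_resGMidBlockτ_of_mem_gen` gives
`f ∈ resGMidBlockτ`; so every τ-LEVEL atom lies in the τ-block, hence (hFIN) their closure, hence `A_⊥`, hence the hull (§1).
* §1 `resGMidBlock_le_iff_resGMidAtom_bot_le` (★: `resGMidBlock ≤ W ↔ A_⊥ ≤ W.toSubmodule` for every closed invariant `W`), `resGMidBlock_le_resGMidBlockτ_iff_gen_bot_subset`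
  (★: `hW1 ↔ resGMidAtomGen ξ μω ⊥ 1 ⊆ resGMidBlockτ` — WHAT hW1 IS).
* §2 (abstract, every compact Hausdorff group, every Hilbert space) `map_charProj_of_commute` (a bounded operator commuting with `σ` commutes with `P_τ`),
  **`mem_of_forall_charProj_mem`** (PETER–WEYL SEPARATION); §2b its `L²(U(J₃)(L⁺)∖U(J₃)(𝔸_{L⁺}))` instance **`mem_closedSubrep_of_forall_kTypeProj_mem`** for any closed
  `R(G(𝔸))`-stable `W` (no letter).
* §3 HEADS: `gen_tauLevel_subset_resGMidBlockτ_of_kTypeStable (hstab)` (every τ-LEVEL generator lies in the τ-block), `resGMidAtom_tauLevel_le_resGMidBlockτ_of_kTypeStable (hstab)`,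
  **`hW1_of_tauStable (hFIN) (hstab) : resGMidBlock L μ ξ μω ≤ resGMidBlockτ L μ ξ μω`** (the letter BYTE FOR BYTE as ★ `res_midBlock_le_residual_of_tauAdmissible` ∕ ★ p864870
  bind it), and the W-form twins `hW1_of_tauLevel_atoms_le (hFIN) (hτ)` ∕ `hW1_of_kTypeCuts_mem (hFIN) (hstabW)` for payers that reach the τ-block but not the τ-generator set.
HONEST LABEL: HC_CM is proved only modulo the 7 printed citations (2 remaining named inputs: hLiu418 = `stmt-HodgeConjecture-24832`, h413 = `stmt-HodgeConjecture-24833`) until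
rung 0 closes; REL ≠ ★ ≠ BUILT; this file PAYS NO SOCKET: `hW1` becomes ★ ∘ {(hFIN) (unowned, M; as true as hW1 at non-smooth data), (hstab) (LH4-p10 (g9) in flight, M; idem)} —
a road, not a payment; the Peter–Weyl step is ★ here; count-neutral.

## References
* [MoeglinWaldspurger1995] C. Mœglin, J.-L. Waldspurger, *Spectral Decomposition and Eisenstein Series* (1995), I.2.17, I.2.18, II.1, V.3.13.
* [BrockerTomDieck1985] T. Bröcker, T. tom Dieck, *Representations of Compact Lie Groups*, GTM 98 (1985), III (5.4), (5.5), Thm. (5.10).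
* [DeitmarEchterhoff2014] A. Deitmar, S. Echterhoff, *Principles of Harmonic Analysis* (2nd ed., 2014), Thm. 7.2.3, Prop. 7.3.3.
* [BorelJacquet1979] A. Borel, H. Jacquet, *Automorphic forms and automorphic representations*, Corvallis PSPM 33.1 (1979), §4.1, §4.6.
* [Rogawski1990] J. D. Rogawski, *Automorphic Representations of Unitary Groups in Three Variables* (1990), §13.9 p. 229 (ii).
-/

set_option autoImplicit false
set_option linter.dupNamespace false  -- the mandated namespace `…HodgeConjecture.HodgeConjecture.R90.S8` (LEAD #1 L1) repeats the summit's segment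

noncomputable section

open MeasureTheory Measure Set Filter Topology NumberField NumberField.mixedEmbedding ContRepresentation
open Literature.NumberTheory Literature.NumberTheory.Automorphic Literature.NumberTheory.Automorphic.UnitaryGroup Literature.NumberTheory.GaloisRepresentations AdelicGroupData
open Literature.NumberTheory.Automorphic.Arthur2013.Leaves.TECR Literature.NumberTheory.Rogawski1990
open Literature.RepresentationTheory.CompactGroups
open Summit.HodgeConjecture.HodgeConjecture.Cruxes.H413.K2E1BorelEisensteinU
open Summit.HodgeConjecture.HodgeConjecture.Cruxes.H413.K2E1ChiSectionSpaceU3PairDefs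
open scoped ENNReal NNReal InnerProductSpace ComplexConjugate

universe u

namespace Summit.HodgeConjecture.HodgeConjecture.R90.S8

/-! ## §1 What `hW1` is: the LEVEL-FREE atom (equivalently its generators) lies in the τ-block -/

section Reduction

variable (L : Type) [Field L] [NumberField L] [IsCMField L]
  (μ : Measure (quasiSplit (↥(maximalRealSubfield L)) L (IsCMField.complexConj L) 3).automorphicQuotient)
  [(quasiSplit (↥(maximalRealSubfield L)) L (IsCMField.complexConj L) 3).IsAutomorphicMeasure μ]
  (ξ : OneDimAutRepH L) (μω : HeckeCharacter L)

/-- **The hull lies below a closed invariant `W` iff the LEVEL-FREE atom does**: `resGMidBlock ξ μω ≤ W ↔ resGMidAtom ξ μω ⊥ 1 ≤ W.toSubmodule` (★ `resGMidBlock_eq_generate_resGMidAtom_bot`: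
the hull is generated by the level-free atom; ★ `ClosedSubrep.generate_le` ∕ `subset_generate`). [cite: MoeglinWaldspurger1995, V.3.13] -/
theorem resGMidBlock_le_iff_resGMidAtom_bot_le (W : ClosedSubrep ((quasiSplit (↥(maximalRealSubfield L)) L (IsCMField.complexConj L) 3).rightRegular μ)) :
    resGMidBlock L μ ξ μω ≤ W ↔ resGMidAtom L μ ξ μω ⊥ 1 ≤ W.toSubmodule := by
  constructor
  · intro h v hv
    exact ClosedSubrep.toSubmodule_le_iff.2 h (resGMidAtom_le_resGMidBlock L μ ξ μω ⊥ 1 hv)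
  · intro h
    rw [resGMidBlock_eq_generate_resGMidAtom_bot]
    exact ClosedSubrep.generate_le fun v hv => h hv

/-- **WHAT `hW1` IS**: `resGMidBlock ξ μω ≤ resGMidBlockτ ξ μω ↔ resGMidAtomGen ξ μω ⊥ 1 ⊆ resGMidBlockτ ξ μω` — every LEVEL-FREE (`K′ = ⊥`: no finite level, no `K_∞`-finiteness)
merely-continuous-section middle-pole residue class lies in the closed `G(𝔸)`-hull of the τ-admissible ones (§1 + the τ-block is closed, so it contains the closed span of what it
contains). [cite: MoeglinWaldspurger1995, II.1, V.3.13] [cite: Rogawski1990, §13.9 p. 229 (ii)] -/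
theorem resGMidBlock_le_resGMidBlockτ_iff_gen_bot_subset :
    resGMidBlock L μ ξ μω ≤ resGMidBlockτ L μ ξ μω ↔
      resGMidAtomGen L μ ξ μω ⊥ 1 ⊆ ((resGMidBlockτ L μ ξ μω).toSubmodule : Set ((quasiSplit (↥(maximalRealSubfield L)) L (IsCMField.complexConj L) 3).L2 μ)) := by
  rw [resGMidBlock_le_iff_resGMidAtom_bot_le]
  constructor
  · intro h f hf
    exact h (mem_resGMidAtom_of_mem_gen L μ ξ μω ⊥ 1 hf)
  · intro h
    rw [resGMidAtom_def]
    exact Submodule.topologicalClosure_minimal _ (Submodule.span_le.2 h) (resGMidBlockτ L μ ξ μω).isClosed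

end Reduction

/-! ## §2 Peter–Weyl separation (abstract): if every `K`-type cut of `f` lies in a closed stable `W`, then `f ∈ W` -/

section Abstract

variable {C : Type*} [Group C] [TopologicalSpace C] [IsTopologicalGroup C] [CompactSpace C] [T2Space C] [MeasurableSpace C] [BorelSpace C]
  (μC : Measure C) [IsProbabilityMeasure μC] [μC.IsMulLeftInvariant]
  {V : Type u} [NormedAddCommGroup V] [InnerProductSpace ℂ V] [CompleteSpace V]

omit [IsTopologicalGroup C] [T2Space C] [μC.IsMulLeftInvariant] in
/-- **A bounded operator commuting with `σ` commutes with every `K`-type cut `P_τ = dim τ • ∫ conj χ_τ(g) • σ g (·) dμ`** (the Bochner integral commutes with bounded operators, Mathlib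
`ContinuousLinearMap.integral_comp_comm`; ★ `Schur.integrable_conj_character_smul_orbit`). [cite: BrockerTomDieck1985, III (5.5)] -/
theorem map_charProj_of_commute {σ : ContRepresentation ℂ C V} (hsc : σ.IsStronglyContinuous)
    {E : Type*} [NormedAddCommGroup E] [InnerProductSpace ℂ E] [FiniteDimensional ℂ E] {τ : ContRepresentation ℂ C E} (hτ : Continuous (τ : C → E →L[ℂ] E))
    (T : V →L[ℂ] V) (hT : ∀ (g : C) (v : V), T (σ g v) = σ g (T v)) (v : V) :
    T (Schur.charProj μC τ σ v) = Schur.charProj μC τ σ (T v) := by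
  rw [Schur.charProj_def, Schur.charProj_def, map_smul, ← T.integral_comp_comm (Schur.integrable_conj_character_smul_orbit μC hτ hsc v)]
  congr 1
  refine integral_congr_ae (Filter.Eventually.of_forall fun g => ?_)
  simp only [map_smul, hT]

/-- **PETER–WEYL SEPARATION.**  `σ` a unitary strongly continuous representation of the compact Hausdorff group `C` on the Hilbert space `V`, `W ≤ V` CLOSED and `σ`-STABLE, `f ∈ V`.
If for EVERY irreducible unitary finite-dimensional `τ` the `K`-type cut `P_τ f = dim τ • ∫ conj χ_τ(g) • σ g f dμ` (★ `Schur.charProj`) lies in `W`, then `f ∈ W`.  Proof: the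
orthogonal projection `P_W` intertwines `σ` (★ `ClosedSubrep.starProjection_map_apply`), so `P_τ (f − P_W f) = P_τ f − P_W (P_τ f) = 0` (`P_τ f ∈ W`); by ★
`charProj_eq_zero_iff_mem_orthogonal` the vector `x := f − P_W f` is orthogonal to every isotypic component `σ.isotypicComponent τ` — in particular (`τ := U.toContRep`, finite-dimensional
★ `finiteDimensional_of_isTopIrreducible_toContRep`, irreducible ★ `isIrreducible_of_isTopIrreducible`, unitary, continuous) to those of the irreducible closed subrepresentations `U`,
whose span is dense (★ `le_topologicalClosure_iSup_inf_isotypicComponent_of_invariant` at `W := ⊤`); so `⟪x, x⟫ = 0`, `x = 0`, `f = P_W f ∈ W`.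
[cite: BrockerTomDieck1985, III Thm (5.10)] [cite: DeitmarEchterhoff2014, Thm. 7.2.3, Prop. 7.3.3] -/
theorem mem_of_forall_charProj_mem {σ : ContRepresentation ℂ C V} (hσ : σ.IsUnitary) (hsc : σ.IsStronglyContinuous)
    (W : Submodule ℂ V) (hWc : IsClosed (W : Set V)) (hWinv : ∀ (c : C), ∀ v ∈ W, σ c v ∈ W) (f : V)
    (h : ∀ (E : Type u) [NormedAddCommGroup E] [InnerProductSpace ℂ E] [FiniteDimensional ℂ E] (τ : ContRepresentation ℂ C E),
      Continuous (τ : C → E →L[ℂ] E) → τ.toRepresentation.IsIrreducible → (∀ (g : C) (v w : E), ⟪τ g v, τ g w⟫_ℂ = ⟪v, w⟫_ℂ) → Schur.charProj μC τ σ f ∈ W) :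
    f ∈ W := by
  haveI : CompleteSpace W := hWc.completeSpace_coe
  -- `W` as a closed subrepresentation; the orthogonal projection onto it intertwines `σ`
  let W' : ClosedSubrep σ := { toSubmodule := W, apply_mem_toSubmodule := fun c v hv => hWinv c v hv, isClosed' := hWc }
  have hPW : ∀ (g : C) (v : V), W.starProjection (σ g v) = σ g (W.starProjection v) := fun g v => W'.starProjection_map_apply hσ g v
  -- `x := f − P_W f` has all its `K`-type cuts equal to zero
  set x : V := f - W.starProjection f with hx
  have hx0 : ∀ (E : Type u) [NormedAddCommGroup E] [InnerProductSpace ℂ E] [FiniteDimensional ℂ E] (τ : ContRepresentation ℂ C E),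
      Continuous (τ : C → E →L[ℂ] E) → τ.toRepresentation.IsIrreducible → (∀ (g : C) (v w : E), ⟪τ g v, τ g w⟫_ℂ = ⟪v, w⟫_ℂ) → Schur.charProj μC τ σ x = 0 := by
    intro E _ _ _ τ hτ hirr hτu
    have hlin : Schur.charProj μC τ σ x = Schur.charProj μC τ σ f - Schur.charProj μC τ σ (W.starProjection f) := by
      rw [hx, sub_eq_add_neg, Schur.charProj_add μC hτ hsc, ← neg_one_smul ℂ (W.starProjection f), Schur.charProj_smul, neg_one_smul, ← sub_eq_add_neg]
    rw [hlin, ← map_charProj_of_commute μC hsc hτ W.starProjection hPW f, Submodule.starProjection_eq_self_iff.2 (h E τ hτ hirr hτu), sub_self]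
  -- hence `x` is orthogonal to the isotypic component of every irreducible closed subrepresentation
  have hxU : ∀ U : {U : ClosedSubrep σ // U.toContRep.IsTopIrreducible}, x ∈ ((σ.isotypicComponent U.1.toContRep).toSubmodule)ᗮ := by
    intro U
    haveI : FiniteDimensional ℂ U.1.toSubmodule := finiteDimensional_of_isTopIrreducible_toContRep hsc U.2
    haveI : U.1.toContRep.toRepresentation.IsIrreducible := isIrreducible_of_isTopIrreducible _ U.2
    have hτc : Continuous (U.1.toContRep : C → U.1.toSubmodule →L[ℂ] U.1.toSubmodule) :=
      Schur.continuous_of_forall_continuous_apply fun w => (isStronglyContinuous_toContRep_of_isStronglyContinuous hsc U.1) w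
    have hτu : ∀ (g : C) (v w : U.1.toSubmodule), ⟪U.1.toContRep g v, U.1.toContRep g w⟫_ℂ = ⟪v, w⟫_ℂ := fun g v w => (hσ.toContRep U.1).inner_map_map g v w
    have h0 := (charProj_eq_zero_iff_mem_orthogonal μC hsc hσ hτc hτu x).1 (hx0 _ U.1.toContRep hτc inferInstance hτu)
    rwa [← ClosedSubrep.mem_toSubmodule, ClosedSubrep.toSubmodule_orthogonal] at h0
  -- Peter–Weyl: the isotypic components of the irreducible closed subrepresentations span a dense subspace
  have hPWd : (⊤ : Submodule ℂ V) ≤ (⨆ U : {U : ClosedSubrep σ // U.toContRep.IsTopIrreducible}, ⊤ ⊓ (σ.isotypicComponent U.1.toContRep).toSubmodule).topologicalClosure :=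
    le_topologicalClosure_iSup_inf_isotypicComponent_of_invariant hσ hsc ⊤ (by rw [Submodule.top_coe]; exact isClosed_univ) (fun _ _ _ => Submodule.mem_top)
  -- `x` is orthogonal to that span, hence to its closure, hence to itself
  have hxS : x ∈ (⨆ U : {U : ClosedSubrep σ // U.toContRep.IsTopIrreducible}, ⊤ ⊓ (σ.isotypicComponent U.1.toContRep).toSubmodule)ᗮ := by
    rw [← Submodule.iInf_orthogonal]
    exact (Submodule.mem_iInf _).2 fun U => Submodule.orthogonal_le (inf_le_right) (hxU U)
  have hxcl : x ∈ ((⨆ U : {U : ClosedSubrep σ // U.toContRep.IsTopIrreducible}, ⊤ ⊓ (σ.isotypicComponent U.1.toContRep).toSubmodule).topologicalClosure)ᗮ := by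
    rwa [← Submodule.orthogonal_closure] at hxS
  have hxx : ⟪x, x⟫_ℂ = 0 := Submodule.inner_right_of_mem_orthogonal (hPWd Submodule.mem_top) hxcl
  have hx0' : x = 0 := inner_self_eq_zero.1 hxx
  -- so `f = P_W f ∈ W`
  have hf : f = W.starProjection f := sub_eq_zero.1 (by rw [← hx]; exact hx0')
  rw [hf]
  exact W.starProjection_apply_mem f

end Abstract

/-! ## §2b The `L²(U(J₃)(L⁺)∖U(J₃)(𝔸_{L⁺}))` instance: `K_∞ = U(J₃)(L⁺⊗ℝ) ∩ U(1⊗1)` acting through `R ∘ ι_∞`, any closed `R(G(𝔸))`-stable `W` -/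

section L2

variable (L : Type) [Field L] [NumberField L] [IsCMField L]
  (μ : Measure (quasiSplit (↥(maximalRealSubfield L)) L (IsCMField.complexConj L) 3).automorphicQuotient)
  [(quasiSplit (↥(maximalRealSubfield L)) L (IsCMField.complexConj L) 3).IsAutomorphicMeasure μ]
  [MeasurableSpace ↥(UnitaryGroup.arch (↥(maximalRealSubfield L)) L (IsCMField.complexConj L) 3 ((StdForm.antidiagonal 3).over L) ⊓ unitaryGroupOfForm (conjMixed (↥(maximalRealSubfield L)) L (IsCMField.complexConj L)) 1)]
  [BorelSpace ↥(UnitaryGroup.arch (↥(maximalRealSubfield L)) L (IsCMField.complexConj L) 3 ((StdForm.antidiagonal 3).over L) ⊓ unitaryGroupOfForm (conjMixed (↥(maximalRealSubfield L)) L (IsCMField.complexConj L)) 1)]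
  (μK : Measure ↥(UnitaryGroup.arch (↥(maximalRealSubfield L)) L (IsCMField.complexConj L) 3 ((StdForm.antidiagonal 3).over L) ⊓ unitaryGroupOfForm (conjMixed (↥(maximalRealSubfield L)) L (IsCMField.complexConj L)) 1))
  [IsProbabilityMeasure μK] [μK.IsMulLeftInvariant]

/-- **`K_∞`-TYPE SEPARATION IN `L²`, NO LETTER.**  `K_∞ = U(J₃)(L⁺⊗ℝ) ∩ U(1⊗1)` (compact ★ `compactSpace_arch_inf_unitaryOne`) acts on `L²(U(J₃)(L⁺)∖U(J₃)(𝔸_{L⁺}))` through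
`ρ := R ∘ ι_∞ ∘ incl` (unitary ★ `isUnitary_rightRegular`, strongly continuous ★ `isStronglyContinuous_rightRegular_holds` ∘ ★ `continuous_archToAdelic` ∘ ★
`continuous_inclusion_arch_inf_unitaryOne`); `μK` a left-invariant probability measure on `K_∞`.  For every CLOSED `R(G(𝔸))`-STABLE `W` and `f ∈ L²`: if for every irreducible unitary
finite-dimensional `τ` of `K_∞` the cut `Schur.charProj μK τ ρ f` lies in `W`, then `f ∈ W` (§2). [cite: BrockerTomDieck1985, III Thm (5.10)] [cite: BorelJacquet1979, §4.1, §4.6] -/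
theorem mem_closedSubrep_of_forall_kTypeProj_mem (W : ClosedSubrep ((quasiSplit (↥(maximalRealSubfield L)) L (IsCMField.complexConj L) 3).rightRegular μ))
    (f : (quasiSplit (↥(maximalRealSubfield L)) L (IsCMField.complexConj L) 3).L2 μ)
    (h : ∀ (E : Type) [NormedAddCommGroup E] [InnerProductSpace ℂ E] [FiniteDimensional ℂ E]
      (τ : ContRepresentation ℂ ↥(UnitaryGroup.arch (↥(maximalRealSubfield L)) L (IsCMField.complexConj L) 3 ((StdForm.antidiagonal 3).over L) ⊓ unitaryGroupOfForm (conjMixed (↥(maximalRealSubfield L)) L (IsCMField.complexConj L)) 1) E),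
      Continuous (τ : ↥(UnitaryGroup.arch (↥(maximalRealSubfield L)) L (IsCMField.complexConj L) 3 ((StdForm.antidiagonal 3).over L) ⊓ unitaryGroupOfForm (conjMixed (↥(maximalRealSubfield L)) L (IsCMField.complexConj L)) 1) → E →L[ℂ] E) →
      τ.toRepresentation.IsIrreducible → (∀ (g : ↥(UnitaryGroup.arch (↥(maximalRealSubfield L)) L (IsCMField.complexConj L) 3 ((StdForm.antidiagonal 3).over L) ⊓ unitaryGroupOfForm (conjMixed (↥(maximalRealSubfield L)) L (IsCMField.complexConj L)) 1)) (v w : E), ⟪τ g v, τ g w⟫_ℂ = ⟪v, w⟫_ℂ) →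
      Schur.charProj μK τ ((((quasiSplit (↥(maximalRealSubfield L)) L (IsCMField.complexConj L) 3).rightRegular μ).restrict
        ((archToAdelic (↥(maximalRealSubfield L)) L (IsCMField.complexConj L) 3 ((StdForm.antidiagonal 3).over L)).comp
          (Subgroup.inclusion (inf_le_left : (UnitaryGroup.arch (↥(maximalRealSubfield L)) L (IsCMField.complexConj L) 3 ((StdForm.antidiagonal 3).over L) ⊓ unitaryGroupOfForm (conjMixed (↥(maximalRealSubfield L)) L (IsCMField.complexConj L)) 1) ≤
            UnitaryGroup.arch (↥(maximalRealSubfield L)) L (IsCMField.complexConj L) 3 ((StdForm.antidiagonal 3).over L)))))) f ∈ W.toSubmodule) :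
    f ∈ W.toSubmodule := by
  haveI : CompactSpace ↥(UnitaryGroup.arch (↥(maximalRealSubfield L)) L (IsCMField.complexConj L) 3 ((StdForm.antidiagonal 3).over L) ⊓ unitaryGroupOfForm (conjMixed (↥(maximalRealSubfield L)) L (IsCMField.complexConj L)) 1) :=
    compactSpace_arch_inf_unitaryOne L 3 ((StdForm.antidiagonal 3).over L)
  have hU := (quasiSplit (↥(maximalRealSubfield L)) L (IsCMField.complexConj L) 3).isUnitary_rightRegular μ
  have hS := (quasiSplit (↥(maximalRealSubfield L)) L (IsCMField.complexConj L) 3).isStronglyContinuous_rightRegular_holds μ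
  have hκc := continuous_inclusion_arch_inf_unitaryOne L 3 ((StdForm.antidiagonal 3).over L)
  refine mem_of_forall_charProj_mem (μC := μK)
    (σ := (((quasiSplit (↥(maximalRealSubfield L)) L (IsCMField.complexConj L) 3).rightRegular μ).restrict
        ((archToAdelic (↥(maximalRealSubfield L)) L (IsCMField.complexConj L) 3 ((StdForm.antidiagonal 3).over L)).comp
          (Subgroup.inclusion (inf_le_left : (UnitaryGroup.arch (↥(maximalRealSubfield L)) L (IsCMField.complexConj L) 3 ((StdForm.antidiagonal 3).over L) ⊓ unitaryGroupOfForm (conjMixed (↥(maximalRealSubfield L)) L (IsCMField.complexConj L)) 1) ≤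
            UnitaryGroup.arch (↥(maximalRealSubfield L)) L (IsCMField.complexConj L) 3 ((StdForm.antidiagonal 3).over L))))))
    (fun k => hU _) (fun v => (hS v).comp ((continuous_archToAdelic (↥(maximalRealSubfield L)) L (IsCMField.complexConj L) 3 ((StdForm.antidiagonal 3).over L)).comp hκc))
    W.toSubmodule W.isClosed (fun k v hv => ?_) f h
  rw [ContRepresentation.restrict_apply]
  exact W.apply_mem _ hv

end L2

/-! ## §3 HEADS: every τ-LEVEL generator lies in the τ-block (from (hstab)); `hW1` from (hFIN) + (hstab); the W-form twins -/

section Heads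

variable (L : Type) [Field L] [NumberField L] [IsCMField L]
  (μ : Measure (quasiSplit (↥(maximalRealSubfield L)) L (IsCMField.complexConj L) 3).automorphicQuotient)
  [(quasiSplit (↥(maximalRealSubfield L)) L (IsCMField.complexConj L) 3).IsAutomorphicMeasure μ]
  (ξ : OneDimAutRepH L) (μω : HeckeCharacter L)

/-- **THE τ-LEVEL ATOMS LIE IN THE τ-BLOCK AS SOON AS THEIR GENERATORS DO** (the τ-block is closed). [cite: MoeglinWaldspurger1995, V.3.13] -/
theorem resGMidAtom_tauLevel_le_resGMidBlockτ_of_gen_subset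
    {U₀ : Subgroup ↥(finAdelic (↥(maximalRealSubfield L)) L (IsCMField.complexConj L) 3 ((StdForm.antidiagonal 3).over L))}
    (h : resGMidAtomGen L μ ξ μω (tauLevel L U₀) 1 ⊆ ((resGMidBlockτ L μ ξ μω).toSubmodule : Set ((quasiSplit (↥(maximalRealSubfield L)) L (IsCMField.complexConj L) 3).L2 μ))) :
    resGMidAtom L μ ξ μω (tauLevel L U₀) 1 ≤ (resGMidBlockτ L μ ξ μω).toSubmodule := by
  rw [resGMidAtom_def]
  exact Submodule.topologicalClosure_minimal _ (Submodule.span_le.2 h) (resGMidBlockτ L μ ξ μω).isClosed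

/-- **`hW1` FROM (hFIN) AND «EVERY τ-LEVEL ATOM LIES IN THE τ-BLOCK»** (W-form, projector-free): the level-free atom lies in the closure of the τ-level atoms (hFIN), each of which lies in the
CLOSED τ-block (`hτ`); §1. [cite: MoeglinWaldspurger1995, II.1, V.3.13] -/
theorem hW1_of_tauLevel_atoms_le
    (hFIN : resGMidAtom L μ ξ μω ⊥ 1 ≤
      (⨆ (U₀ : Subgroup ↥(finAdelic (↥(maximalRealSubfield L)) L (IsCMField.complexConj L) 3 ((StdForm.antidiagonal 3).over L))) (_ : IsTauLevel L U₀),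
        resGMidAtom L μ ξ μω (tauLevel L U₀) 1).topologicalClosure)
    (hτ : ∀ (U₀ : Subgroup ↥(finAdelic (↥(maximalRealSubfield L)) L (IsCMField.complexConj L) 3 ((StdForm.antidiagonal 3).over L))), IsTauLevel L U₀ →
      resGMidAtom L μ ξ μω (tauLevel L U₀) 1 ≤ (resGMidBlockτ L μ ξ μω).toSubmodule) :
    resGMidBlock L μ ξ μω ≤ resGMidBlockτ L μ ξ μω := by
  rw [resGMidBlock_le_iff_resGMidAtom_bot_le]
  exact hFIN.trans (Submodule.topologicalClosure_minimal _ (iSup_le fun U₀ => iSup_le fun hU₀ => hτ U₀ hU₀) (resGMidBlockτ L μ ξ μω).isClosed)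

variable
  [MeasurableSpace ↥(UnitaryGroup.arch (↥(maximalRealSubfield L)) L (IsCMField.complexConj L) 3 ((StdForm.antidiagonal 3).over L) ⊓ unitaryGroupOfForm (conjMixed (↥(maximalRealSubfield L)) L (IsCMField.complexConj L)) 1)]
  [BorelSpace ↥(UnitaryGroup.arch (↥(maximalRealSubfield L)) L (IsCMField.complexConj L) 3 ((StdForm.antidiagonal 3).over L) ⊓ unitaryGroupOfForm (conjMixed (↥(maximalRealSubfield L)) L (IsCMField.complexConj L)) 1)]
  (μK : Measure ↥(UnitaryGroup.arch (↥(maximalRealSubfield L)) L (IsCMField.complexConj L) 3 ((StdForm.antidiagonal 3).over L) ⊓ unitaryGroupOfForm (conjMixed (↥(maximalRealSubfield L)) L (IsCMField.complexConj L)) 1))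
  [IsProbabilityMeasure μK] [μK.IsMulLeftInvariant]

/-- **`hW1` FROM (hFIN) AND THE W-FORM `K_∞`-TYPE LETTER (hstabW)** «for every τ-level `U₀`, every generator `f` at level `(ι_f U₀, 1)` and every irreducible unitary finite-dimensional `τ`
of `K_∞`, the cut `Schur.charProj μK τ (R ∘ ι_∞|_{K_∞}) f` lies in the τ-BLOCK» — the weakest `K_∞`-side letter this road accepts (§2b separation at `W := resGMidBlockτ`, then
`hW1_of_tauLevel_atoms_le`). [cite: BrockerTomDieck1985, III Thm (5.10)] [cite: MoeglinWaldspurger1995, II.1, V.3.13] -/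
theorem hW1_of_kTypeCuts_mem
    (hFIN : resGMidAtom L μ ξ μω ⊥ 1 ≤
      (⨆ (U₀ : Subgroup ↥(finAdelic (↥(maximalRealSubfield L)) L (IsCMField.complexConj L) 3 ((StdForm.antidiagonal 3).over L))) (_ : IsTauLevel L U₀),
        resGMidAtom L μ ξ μω (tauLevel L U₀) 1).topologicalClosure)
    (hstabW : ∀ (U₀ : Subgroup ↥(finAdelic (↥(maximalRealSubfield L)) L (IsCMField.complexConj L) 3 ((StdForm.antidiagonal 3).over L))) (_ : IsTauLevel L U₀)
      (f : (quasiSplit (↥(maximalRealSubfield L)) L (IsCMField.complexConj L) 3).L2 μ) (_ : f ∈ resGMidAtomGen L μ ξ μω (tauLevel L U₀) 1)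
      (E : Type) [NormedAddCommGroup E] [InnerProductSpace ℂ E] [FiniteDimensional ℂ E]
      (τ : ContRepresentation ℂ ↥(UnitaryGroup.arch (↥(maximalRealSubfield L)) L (IsCMField.complexConj L) 3 ((StdForm.antidiagonal 3).over L) ⊓ unitaryGroupOfForm (conjMixed (↥(maximalRealSubfield L)) L (IsCMField.complexConj L)) 1) E)
      (_ : Continuous (τ : ↥(UnitaryGroup.arch (↥(maximalRealSubfield L)) L (IsCMField.complexConj L) 3 ((StdForm.antidiagonal 3).over L) ⊓ unitaryGroupOfForm (conjMixed (↥(maximalRealSubfield L)) L (IsCMField.complexConj L)) 1) → E →L[ℂ] E))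
      (_ : τ.toRepresentation.IsIrreducible)
      (_ : ∀ (g : ↥(UnitaryGroup.arch (↥(maximalRealSubfield L)) L (IsCMField.complexConj L) 3 ((StdForm.antidiagonal 3).over L) ⊓ unitaryGroupOfForm (conjMixed (↥(maximalRealSubfield L)) L (IsCMField.complexConj L)) 1)) (v w : E), ⟪τ g v, τ g w⟫_ℂ = ⟪v, w⟫_ℂ),
      Schur.charProj μK τ ((((quasiSplit (↥(maximalRealSubfield L)) L (IsCMField.complexConj L) 3).rightRegular μ).restrict
        ((archToAdelic (↥(maximalRealSubfield L)) L (IsCMField.complexConj L) 3 ((StdForm.antidiagonal 3).over L)).comp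
          (Subgroup.inclusion (inf_le_left : (UnitaryGroup.arch (↥(maximalRealSubfield L)) L (IsCMField.complexConj L) 3 ((StdForm.antidiagonal 3).over L) ⊓ unitaryGroupOfForm (conjMixed (↥(maximalRealSubfield L)) L (IsCMField.complexConj L)) 1) ≤
            UnitaryGroup.arch (↥(maximalRealSubfield L)) L (IsCMField.complexConj L) 3 ((StdForm.antidiagonal 3).over L)))))) f ∈ (resGMidBlockτ L μ ξ μω).toSubmodule) :
    resGMidBlock L μ ξ μω ≤ resGMidBlockτ L μ ξ μω :=
  hW1_of_tauLevel_atoms_le L μ ξ μω hFIN fun U₀ hU₀ =>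
    resGMidAtom_tauLevel_le_resGMidBlockτ_of_gen_subset L μ ξ μω fun f hf =>
      mem_closedSubrep_of_forall_kTypeProj_mem L μ μK (resGMidBlockτ L μ ξ μω) f fun E _ _ _ τ hτc hirr hτu => hstabW U₀ hU₀ f hf E τ hτc hirr hτu

/-- **EVERY τ-LEVEL GENERATOR LIES IN THE τ-BLOCK, FROM (hstab)** «for every τ-level `U₀`, every generator `f ∈ resGMidAtomGen ξ μω (ι_f U₀) 1` and every irreducible unitary
finite-dimensional `τ` of `K_∞`, the `K_∞`-type cut `Schur.charProj μK τ (R ∘ ι_∞|_{K_∞}) f` is a τ-ADMISSIBLE generator `∈ resGMidAtomGenτ ξ μω U₀`» (LH4-p10 (g9)'s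
`admissible_kTypeProj` read in `L²`): each cut lies in the τ-block (★ `mem_resGMidBlockτ_of_mem_gen`), so §2b puts `f` there.  No Peter–Weyl letter.
[cite: BrockerTomDieck1985, III Thm (5.10)] [cite: MoeglinWaldspurger1995, II.1, V.3.13] -/
theorem gen_tauLevel_subset_resGMidBlockτ_of_kTypeStable
    (hstab : ∀ (U₀ : Subgroup ↥(finAdelic (↥(maximalRealSubfield L)) L (IsCMField.complexConj L) 3 ((StdForm.antidiagonal 3).over L))) (_ : IsTauLevel L U₀)
      (f : (quasiSplit (↥(maximalRealSubfield L)) L (IsCMField.complexConj L) 3).L2 μ) (_ : f ∈ resGMidAtomGen L μ ξ μω (tauLevel L U₀) 1)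
      (E : Type) [NormedAddCommGroup E] [InnerProductSpace ℂ E] [FiniteDimensional ℂ E]
      (τ : ContRepresentation ℂ ↥(UnitaryGroup.arch (↥(maximalRealSubfield L)) L (IsCMField.complexConj L) 3 ((StdForm.antidiagonal 3).over L) ⊓ unitaryGroupOfForm (conjMixed (↥(maximalRealSubfield L)) L (IsCMField.complexConj L)) 1) E)
      (_ : Continuous (τ : ↥(UnitaryGroup.arch (↥(maximalRealSubfield L)) L (IsCMField.complexConj L) 3 ((StdForm.antidiagonal 3).over L) ⊓ unitaryGroupOfForm (conjMixed (↥(maximalRealSubfield L)) L (IsCMField.complexConj L)) 1) → E →L[ℂ] E))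
      (_ : τ.toRepresentation.IsIrreducible)
      (_ : ∀ (g : ↥(UnitaryGroup.arch (↥(maximalRealSubfield L)) L (IsCMField.complexConj L) 3 ((StdForm.antidiagonal 3).over L) ⊓ unitaryGroupOfForm (conjMixed (↥(maximalRealSubfield L)) L (IsCMField.complexConj L)) 1)) (v w : E), ⟪τ g v, τ g w⟫_ℂ = ⟪v, w⟫_ℂ),
      Schur.charProj μK τ ((((quasiSplit (↥(maximalRealSubfield L)) L (IsCMField.complexConj L) 3).rightRegular μ).restrict
        ((archToAdelic (↥(maximalRealSubfield L)) L (IsCMField.complexConj L) 3 ((StdForm.antidiagonal 3).over L)).comp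
          (Subgroup.inclusion (inf_le_left : (UnitaryGroup.arch (↥(maximalRealSubfield L)) L (IsCMField.complexConj L) 3 ((StdForm.antidiagonal 3).over L) ⊓ unitaryGroupOfForm (conjMixed (↥(maximalRealSubfield L)) L (IsCMField.complexConj L)) 1) ≤
            UnitaryGroup.arch (↥(maximalRealSubfield L)) L (IsCMField.complexConj L) 3 ((StdForm.antidiagonal 3).over L)))))) f ∈ resGMidAtomGenτ L μ ξ μω U₀)
    {U₀ : Subgroup ↥(finAdelic (↥(maximalRealSubfield L)) L (IsCMField.complexConj L) 3 ((StdForm.antidiagonal 3).over L))} (hU₀ : IsTauLevel L U₀) :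
    resGMidAtomGen L μ ξ μω (tauLevel L U₀) 1 ⊆ ((resGMidBlockτ L μ ξ μω).toSubmodule : Set ((quasiSplit (↥(maximalRealSubfield L)) L (IsCMField.complexConj L) 3).L2 μ)) :=
  fun f hf => mem_closedSubrep_of_forall_kTypeProj_mem L μ μK (resGMidBlockτ L μ ξ μω) f fun E _ _ _ τ hτc hirr hτu =>
    mem_resGMidBlockτ_of_mem_gen L μ ξ μω hU₀ (hstab U₀ hU₀ f hf E τ hτc hirr hτu)

/-- **EVERY τ-LEVEL ATOM LIES IN THE τ-BLOCK, FROM (hstab)** (closed span of the previous). [cite: MoeglinWaldspurger1995, V.3.13] -/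
theorem resGMidAtom_tauLevel_le_resGMidBlockτ_of_kTypeStable
    (hstab : ∀ (U₀ : Subgroup ↥(finAdelic (↥(maximalRealSubfield L)) L (IsCMField.complexConj L) 3 ((StdForm.antidiagonal 3).over L))) (_ : IsTauLevel L U₀)
      (f : (quasiSplit (↥(maximalRealSubfield L)) L (IsCMField.complexConj L) 3).L2 μ) (_ : f ∈ resGMidAtomGen L μ ξ μω (tauLevel L U₀) 1)
      (E : Type) [NormedAddCommGroup E] [InnerProductSpace ℂ E] [FiniteDimensional ℂ E]
      (τ : ContRepresentation ℂ ↥(UnitaryGroup.arch (↥(maximalRealSubfield L)) L (IsCMField.complexConj L) 3 ((StdForm.antidiagonal 3).over L) ⊓ unitaryGroupOfForm (conjMixed (↥(maximalRealSubfield L)) L (IsCMField.complexConj L)) 1) E)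
      (_ : Continuous (τ : ↥(UnitaryGroup.arch (↥(maximalRealSubfield L)) L (IsCMField.complexConj L) 3 ((StdForm.antidiagonal 3).over L) ⊓ unitaryGroupOfForm (conjMixed (↥(maximalRealSubfield L)) L (IsCMField.complexConj L)) 1) → E →L[ℂ] E))
      (_ : τ.toRepresentation.IsIrreducible)
      (_ : ∀ (g : ↥(UnitaryGroup.arch (↥(maximalRealSubfield L)) L (IsCMField.complexConj L) 3 ((StdForm.antidiagonal 3).over L) ⊓ unitaryGroupOfForm (conjMixed (↥(maximalRealSubfield L)) L (IsCMField.complexConj L)) 1)) (v w : E), ⟪τ g v, τ g w⟫_ℂ = ⟪v, w⟫_ℂ),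
      Schur.charProj μK τ ((((quasiSplit (↥(maximalRealSubfield L)) L (IsCMField.complexConj L) 3).rightRegular μ).restrict
        ((archToAdelic (↥(maximalRealSubfield L)) L (IsCMField.complexConj L) 3 ((StdForm.antidiagonal 3).over L)).comp
          (Subgroup.inclusion (inf_le_left : (UnitaryGroup.arch (↥(maximalRealSubfield L)) L (IsCMField.complexConj L) 3 ((StdForm.antidiagonal 3).over L) ⊓ unitaryGroupOfForm (conjMixed (↥(maximalRealSubfield L)) L (IsCMField.complexConj L)) 1) ≤
            UnitaryGroup.arch (↥(maximalRealSubfield L)) L (IsCMField.complexConj L) 3 ((StdForm.antidiagonal 3).over L)))))) f ∈ resGMidAtomGenτ L μ ξ μω U₀)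
    {U₀ : Subgroup ↥(finAdelic (↥(maximalRealSubfield L)) L (IsCMField.complexConj L) 3 ((StdForm.antidiagonal 3).over L))} (hU₀ : IsTauLevel L U₀) :
    resGMidAtom L μ ξ μω (tauLevel L U₀) 1 ≤ (resGMidBlockτ L μ ξ μω).toSubmodule :=
  resGMidAtom_tauLevel_le_resGMidBlockτ_of_gen_subset L μ ξ μω (gen_tauLevel_subset_resGMidBlockτ_of_kTypeStable L μ ξ μω μK hstab hU₀)

/-- **HEAD — `hW1` OF (R)′ ∕ (M) ∕ (V♭), BYTE FOR BYTE, FROM THE TWO NAMED LETTERS (hFIN) + (hstab)** (the Peter–Weyl step is §2, no letter): `resGMidBlock L μ ξ μω ≤ resGMidBlockτ L μ ξ μω`.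
(hFIN) = finite-adelic smoothing «the level-free atom lies in the closure of the τ-LEVEL atoms» (level idempotents ★ `exists_levelIdempotent` → 1 strongly; M, unowned); (hstab) =
`K_∞`-type stability at τ-levels «the `K_∞`-type cut ★ `Schur.charProj μK τ (R ∘ ι_∞|_{K_∞}) f` of a τ-level generator is a τ-admissible generator» (LH4-p10 (g9)
`admissible_kTypeProj`, M).  Bind: ★ `res_midBlock_le_residual_of_tauAdmissible (hW1 := hW1_of_tauStable L μ ξ μω μK hFIN hstab) …`, ★ p864870
`resGMidBlock_eq_bot_of_not_lHalfNeZero_of_record (hW1 := …) …`. [cite: MoeglinWaldspurger1995, I.2.17, II.1, V.3.13] [cite: BrockerTomDieck1985, III Thm (5.10)]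
[cite: Rogawski1990, §13.9 p. 229 (ii)] -/
theorem hW1_of_tauStable
    (hFIN : resGMidAtom L μ ξ μω ⊥ 1 ≤
      (⨆ (U₀ : Subgroup ↥(finAdelic (↥(maximalRealSubfield L)) L (IsCMField.complexConj L) 3 ((StdForm.antidiagonal 3).over L))) (_ : IsTauLevel L U₀),
        resGMidAtom L μ ξ μω (tauLevel L U₀) 1).topologicalClosure)
    (hstab : ∀ (U₀ : Subgroup ↥(finAdelic (↥(maximalRealSubfield L)) L (IsCMField.complexConj L) 3 ((StdForm.antidiagonal 3).over L))) (_ : IsTauLevel L U₀)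
      (f : (quasiSplit (↥(maximalRealSubfield L)) L (IsCMField.complexConj L) 3).L2 μ) (_ : f ∈ resGMidAtomGen L μ ξ μω (tauLevel L U₀) 1)
      (E : Type) [NormedAddCommGroup E] [InnerProductSpace ℂ E] [FiniteDimensional ℂ E]
      (τ : ContRepresentation ℂ ↥(UnitaryGroup.arch (↥(maximalRealSubfield L)) L (IsCMField.complexConj L) 3 ((StdForm.antidiagonal 3).over L) ⊓ unitaryGroupOfForm (conjMixed (↥(maximalRealSubfield L)) L (IsCMField.complexConj L)) 1) E)
      (_ : Continuous (τ : ↥(UnitaryGroup.arch (↥(maximalRealSubfield L)) L (IsCMField.complexConj L) 3 ((StdForm.antidiagonal 3).over L) ⊓ unitaryGroupOfForm (conjMixed (↥(maximalRealSubfield L)) L (IsCMField.complexConj L)) 1) → E →L[ℂ] E))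
      (_ : τ.toRepresentation.IsIrreducible)
      (_ : ∀ (g : ↥(UnitaryGroup.arch (↥(maximalRealSubfield L)) L (IsCMField.complexConj L) 3 ((StdForm.antidiagonal 3).over L) ⊓ unitaryGroupOfForm (conjMixed (↥(maximalRealSubfield L)) L (IsCMField.complexConj L)) 1)) (v w : E), ⟪τ g v, τ g w⟫_ℂ = ⟪v, w⟫_ℂ),
      Schur.charProj μK τ ((((quasiSplit (↥(maximalRealSubfield L)) L (IsCMField.complexConj L) 3).rightRegular μ).restrict
        ((archToAdelic (↥(maximalRealSubfield L)) L (IsCMField.complexConj L) 3 ((StdForm.antidiagonal 3).over L)).comp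
          (Subgroup.inclusion (inf_le_left : (UnitaryGroup.arch (↥(maximalRealSubfield L)) L (IsCMField.complexConj L) 3 ((StdForm.antidiagonal 3).over L) ⊓ unitaryGroupOfForm (conjMixed (↥(maximalRealSubfield L)) L (IsCMField.complexConj L)) 1) ≤
            UnitaryGroup.arch (↥(maximalRealSubfield L)) L (IsCMField.complexConj L) 3 ((StdForm.antidiagonal 3).over L)))))) f ∈ resGMidAtomGenτ L μ ξ μω U₀) :
    resGMidBlock L μ ξ μω ≤ resGMidBlockτ L μ ξ μω :=
  hW1_of_tauLevel_atoms_le L μ ξ μω hFIN fun _ hU₀ => resGMidAtom_tauLevel_le_resGMidBlockτ_of_kTypeStable L μ ξ μω μK hstab hU₀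

/-- **Under the two letters the two hulls COINCIDE**: `resGMidBlockτ ξ μω = resGMidBlock ξ μω` (★ `resGMidBlockτ_le_resGMidBlock` + the head) — «the `K`-finite middle-pole residues generate»
[MW95 II.1, V.3.13]. [cite: MoeglinWaldspurger1995, II.1, V.3.13] -/
theorem resGMidBlockτ_eq_resGMidBlock_of_tauStable
    (hFIN : resGMidAtom L μ ξ μω ⊥ 1 ≤
      (⨆ (U₀ : Subgroup ↥(finAdelic (↥(maximalRealSubfield L)) L (IsCMField.complexConj L) 3 ((StdForm.antidiagonal 3).over L))) (_ : IsTauLevel L U₀),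
        resGMidAtom L μ ξ μω (tauLevel L U₀) 1).topologicalClosure)
    (hstab : ∀ (U₀ : Subgroup ↥(finAdelic (↥(maximalRealSubfield L)) L (IsCMField.complexConj L) 3 ((StdForm.antidiagonal 3).over L))) (_ : IsTauLevel L U₀)
      (f : (quasiSplit (↥(maximalRealSubfield L)) L (IsCMField.complexConj L) 3).L2 μ) (_ : f ∈ resGMidAtomGen L μ ξ μω (tauLevel L U₀) 1)
      (E : Type) [NormedAddCommGroup E] [InnerProductSpace ℂ E] [FiniteDimensional ℂ E]
      (τ : ContRepresentation ℂ ↥(UnitaryGroup.arch (↥(maximalRealSubfield L)) L (IsCMField.complexConj L) 3 ((StdForm.antidiagonal 3).over L) ⊓ unitaryGroupOfForm (conjMixed (↥(maximalRealSubfield L)) L (IsCMField.complexConj L)) 1) E)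
      (_ : Continuous (τ : ↥(UnitaryGroup.arch (↥(maximalRealSubfield L)) L (IsCMField.complexConj L) 3 ((StdForm.antidiagonal 3).over L) ⊓ unitaryGroupOfForm (conjMixed (↥(maximalRealSubfield L)) L (IsCMField.complexConj L)) 1) → E →L[ℂ] E))
      (_ : τ.toRepresentation.IsIrreducible)
      (_ : ∀ (g : ↥(UnitaryGroup.arch (↥(maximalRealSubfield L)) L (IsCMField.complexConj L) 3 ((StdForm.antidiagonal 3).over L) ⊓ unitaryGroupOfForm (conjMixed (↥(maximalRealSubfield L)) L (IsCMField.complexConj L)) 1)) (v w : E), ⟪τ g v, τ g w⟫_ℂ = ⟪v, w⟫_ℂ),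
      Schur.charProj μK τ ((((quasiSplit (↥(maximalRealSubfield L)) L (IsCMField.complexConj L) 3).rightRegular μ).restrict
        ((archToAdelic (↥(maximalRealSubfield L)) L (IsCMField.complexConj L) 3 ((StdForm.antidiagonal 3).over L)).comp
          (Subgroup.inclusion (inf_le_left : (UnitaryGroup.arch (↥(maximalRealSubfield L)) L (IsCMField.complexConj L) 3 ((StdForm.antidiagonal 3).over L) ⊓ unitaryGroupOfForm (conjMixed (↥(maximalRealSubfield L)) L (IsCMField.complexConj L)) 1) ≤
            UnitaryGroup.arch (↥(maximalRealSubfield L)) L (IsCMField.complexConj L) 3 ((StdForm.antidiagonal 3).over L)))))) f ∈ resGMidAtomGenτ L μ ξ μω U₀) :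
    resGMidBlockτ L μ ξ μω = resGMidBlock L μ ξ μω :=
  le_antisymm (resGMidBlockτ_le_resGMidBlock L μ ξ μω) (hW1_of_tauStable L μ ξ μω μK hFIN hstab)

end Heads

end Summit.HodgeConjecture.HodgeConjecture.R90.S8

end
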